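import Mathlib
import Summits.PneNP.PneNP.Theses.SymmetryBudget
import Summits.PneNP.PneNP.Theorems.HamCompiles.Negative.NonuniformCollapse
import Literature.Computability.Complexity.CircuitDAG
import Literature.Computability.Complexity.DeMorganSimulation

/-!
# PneNP / SymmetryBudget — item `Symmetrise` (stmt-PneNP-2146): the `g!`-symmetrisation sandwich

Route `PneNP/SymmetryBudget`, support item stmt-PneNP-2146 (`Symmetrise`, rank 9), the bridge
edge of the route's cliff and the canary of its inline symmetry predicate `Sym`:

  there is a constant `c` (we take `c = 12`) such that for all `m g`, every
  `Bud(m,g)`-invariant `f : (Fin m × Fin m → Bool) → Bool` and every `B₂`-circuit `C`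
  computing `f`, some `Bud(m,g)`-symmetric `tcBasis`-circuit of size `≤ c · (g! · (|C| + 1))`
  computes `f`.

Proof (Anderson–Dawar 2017, §1–2, folklore "symmetrisation"; Jukna 2012, §1.2 for the basis
change). For `m = 0` the function is constant and one `∧₀`/`∨₀` gate does it. For `m ≥ 1`:
(1) rewrite `C` over `{∧₂, ∨₂, ¬} ⊆ tcBasis` with `≤ 12|C| + 3` gates
(`Circuit.exists_deMorgan_of_B2`, `HamCompiles.Negative.deMorganBasis_subset_tcBasis`);
(2) SYMMETRISE (`symmetrise_exists_symmetrisation`, for any finite subgroup `Γ ≤ Sym(Fin m)` and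
any circuit): lay out the `|Γ|` relabelled copies `C ∘ (ρ × ρ)`,
`ρ ∈ Γ`, and conjoin their outputs with one `∧_{|Γ|}` gate; `ρ' ∈ Γ` acts on the copies by left
multiplication, the `∧` gate is fixed and its argument list is permuted, the argument lists of
the copies correspond literally — this is done on the labelled-DAG form of circuits
(`GateDAG`, gate type `Option (Γ × Fin |C|)`) and compiled back to a straight-line program
(`GateDAG.compile`, `GateDAG.isSymmetricUnder_compile_iff`); (3) `|Bud(m,g)| = (min g m)! ≤ g!`
(`symmetrise_card_budgetSubgroup_le`), so the size is `≤ g!(12|C|+3)+1 ≤ 12 · g! · (|C|+1)`, and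
by invariance of `f` the conjunction of the copies computes `f`.

The closing theorem `symmetrise_proof` has literally the type of the route decl
`Summit.PneNP.PneNP.Theses.SymmetryBudget.Symmetrise`; the inline `let Sym/HasSym/Bud` of the
route unfold definitionally to `Circuit.IsSymmetricUnder`, `HasSymCircuit tcBasis`,
`pointStabiliserBudget` (`Circuit.isSymmetricUnder_iff` is `Iff.rfl`).

References: M. Anderson, A. Dawar, *On symmetric circuits and fixed-point logics*, Theory
Comput. Syst. 60 (2017), §1–2 [AndersonDawar2016]; S. Jukna, *Boolean Function Complexity*
(2012), §1.2 [Jukna2012]; H. Vollmer, *Introduction to Circuit Complexity* (1999), §1.1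
[Vollmer1999].
-/

-- `Summit.PneNP.PneNP.…` duplicates `PneNP` BY DESIGN (single-problem summit, D-0017); the
-- Summits library sets this option globally (lakefile); repeated here so that a standalone
-- `lean check` is warning-free.
set_option linter.dupNamespace false

namespace Summit.PneNP.PneNP.Theorems

open Literature.Computability.Complexity

/-- **The symmetry budget has at most `g!` elements**: `Bud(m,g)`, the pointwise stabiliser of
the first `m - g` points of `Fin m`, is the symmetric group on the last `min g m` points, so
`|Bud(m,g)| = (min g m)! ≤ g!`. [folklore] -/
theorem symmetrise_card_budgetSubgroup_le (m g : ℕ) [Fintype ↥(budgetSubgroup m g)] :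
    Fintype.card ↥(budgetSubgroup m g) ≤ Nat.factorial g := by
  classical
  let p : Fin m → Prop := fun i => ¬ ((i : ℕ) + g < m)
  have e1 : ↥(budgetSubgroup m g) ≃ {ρ : Equiv.Perm (Fin m) // ∀ a, ¬ p a → ρ a = a} :=
    Equiv.subtypeEquivRight fun ρ => by
      rw [← SetLike.mem_coe, coe_budgetSubgroup, mem_pointStabiliserBudget_iff]
      simp only [p, not_not]
  have e2 : {ρ : Equiv.Perm (Fin m) // ∀ a, ¬ p a → ρ a = a} ≃ Equiv.Perm (Subtype p) :=
    (Equiv.Perm.subtypeEquivSubtypePerm p).symm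
  have hsub : Fintype.card (Subtype p) ≤ g := by
    let φ : Subtype p → Fin g := fun i =>
      ⟨(i.1 : ℕ) + g - m, by
        have h1 := i.1.2
        have h2 : ¬ ((i.1 : ℕ) + g < m) := i.2
        omega⟩
    have hinj : Function.Injective φ := by
      intro i j h
      have h' : (i.1 : ℕ) + g - m = (j.1 : ℕ) + g - m := by
        simpa only [φ, Fin.mk.injEq] using h
      have hi : ¬ ((i.1 : ℕ) + g < m) := i.2
      have hj : ¬ ((j.1 : ℕ) + g < m) := j.2
      exact Subtype.ext (Fin.ext (by omega))
    simpa using Fintype.card_le_of_injective φ hinj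
  calc Fintype.card ↥(budgetSubgroup m g)
      = Fintype.card (Equiv.Perm (Subtype p)) := Fintype.card_congr (e1.trans e2)
    _ = (Fintype.card (Subtype p)).factorial := Fintype.card_perm
    _ ≤ g.factorial := Nat.factorial_le hsub

/-- **Symmetrisation** (Anderson–Dawar 2017, §1: "any circuit can be made symmetric by taking
`|Γ|` copies"). For a finite subgroup `Γ ≤ Sym(Fin m)` and ANY straight-line circuit `C` on
`m × m` matrix inputs there is a circuit `S` with `|Γ| · |C| + 1` gates — the `|Γ|` relabelled
copies `C ∘ (ρ × ρ)`, `ρ ∈ Γ`, and one `∧_{|Γ|}` gate conjoining their outputs — which is over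
`B ∪ {∧_{|Γ|}}` whenever `C` is over `B`, is `Γ`-symmetric (`ρ' ∈ Γ` acts on the copies by left
multiplication and fixes the `∧` gate), and computes `x ↦ ⋀_{ρ ∈ Γ} C (x ∘ (ρ × ρ))`.
Built on the labelled-DAG form of circuits (`GateDAG`, gate type `Option (Γ × Fin |C|)`) and
compiled to a straight-line program. [folklore] -/
theorem symmetrise_exists_symmetrisation {m : ℕ} (Γ : Subgroup (Equiv.Perm (Fin m)))
    [Fintype ↥Γ] (C : Circuit (Fin m × Fin m)) :
    ∃ S : Circuit (Fin m × Fin m),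
      S.size = Fintype.card ↥Γ * C.size + 1 ∧
      (∀ B : Set GateFn, C.IsOver B → S.IsOver (insert (GateFn.and (Fintype.card ↥Γ)) B)) ∧
      S.IsSymmetricUnder (Γ : Set (Equiv.Perm (Fin m))) ∧
      ∀ x : Fin m × Fin m → Bool, S.eval x = decide (∀ ρ : ↥Γ,
        C.eval (fun q : Fin m × Fin m =>
          x ((ρ : Equiv.Perm (Fin m)) q.1, (ρ : Equiv.Perm (Fin m)) q.2)) = true) := by
  -- notation: `N` copies indexed by `↥Γ`, `dg ρ` the diagonal action, `oc` the DAG of `C`,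
  -- `cw e` the embedding of the wires of `C` as the wires of copy `e`
  let N : ℕ := Fintype.card ↥Γ
  let enum : ↥Γ ≃ Fin N := Fintype.equivFin ↥Γ
  let dg : Equiv.Perm (Fin m) → Fin m × Fin m → Fin m × Fin m := fun ρ q => (ρ q.1, ρ q.2)
  let oc : GateDAG (Fin m × Fin m) (Fin C.gates.length) := GateDAG.ofCircuit C
  let cw : ↥Γ → (Fin m × Fin m) ⊕ Fin C.gates.length →
      (Fin m × Fin m) ⊕ Option (↥Γ × Fin C.gates.length) :=
    fun e => Sum.map (dg e) (fun k => some (e, k))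
  -- gate functions and wires of the symmetrised DAG
  let fnD : Option (↥Γ × Fin C.gates.length) → GateFn := fun l =>
    match l with
    | none => GateFn.and N
    | some p => oc.fn p.2
  let argsD : ∀ l : Option (↥Γ × Fin C.gates.length),
      Fin (fnD l).1 → (Fin m × Fin m) ⊕ Option (↥Γ × Fin C.gates.length) := fun l =>
    match l with
    | none => fun a => cw (enum.symm a) oc.out
    | some p => fun a => cw p.1 (oc.args p.2 a)
  -- a gate wire of copy `e` is a gate of copy `e`
  have hcw : ∀ (e : ↥Γ) (w : (Fin m × Fin m) ⊕ Fin C.gates.length)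
      (l' : Option (↥Γ × Fin C.gates.length)),
      cw e w = Sum.inr l' → ∃ k', w = Sum.inr k' ∧ l' = some (e, k') := by
    intro e w l' h
    cases w with
    | inl q => exact absurd h Sum.inl_ne_inr
    | inr k' => exact ⟨k', rfl, (Sum.inr_injective h).symm⟩
  -- acyclicity, by the measure: copy gate `(e, k) ↦ k`, top gate `↦ |C|`
  let μ : Option (↥Γ × Fin C.gates.length) → ℕ := fun l =>
    match l with
    | none => C.gates.length
    | some p => (p.2 : ℕ)
  have hwf : WellFounded (fun l' l : Option (↥Γ × Fin C.gates.length) =>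
      ∃ a, argsD l a = Sum.inr l') := by
    refine Subrelation.wf ?_ (InvImage.wf μ wellFounded_lt)
    intro l' l h
    obtain ⟨a, ha⟩ := h
    show μ l' < μ l
    cases l with
    | none =>
      obtain ⟨k', -, rfl⟩ := hcw (enum.symm a) oc.out l' ha
      exact k'.2
    | some p =>
      obtain ⟨k', hk', rfl⟩ := hcw p.1 (oc.args p.2 a) l' ha
      exact GateDAG.ofCircuit_child_lt C ⟨a, hk'⟩
  let D : GateDAG (Fin m × Fin m) (Option (↥Γ × Fin C.gates.length)) :=
    { fn := fnD, args := argsD, out := Sum.inr none, wf := hwf }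
  -- the value of gate `k` of copy `e` on `x` is the value of gate `k` of `C` on `x ∘ (e × e)`
  have hval : ∀ (x : Fin m × Fin m → Bool) (e : ↥Γ) (k : Fin C.gates.length),
      D.val x (some (e, k)) = oc.val (x ∘ dg e) k := by
    intro x e k
    induction k using oc.wf_child.induction with
    | _ k ih =>
      rw [D.val_eq x (some (e, k)), oc.val_eq (x ∘ dg e) k]
      show (oc.fn k).2 (fun a => GateDAG.wire x (D.val x) (cw e (oc.args k a))) =
        (oc.fn k).2 (fun a => GateDAG.wire (x ∘ dg e) (oc.val (x ∘ dg e)) (oc.args k a))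
      refine congrArg (oc.fn k).2 (funext fun a => ?_)
      cases hka : oc.args k a with
      | inl q => rfl
      | inr k' => exact ih k' ⟨a, hka⟩
  -- hence the output wire of copy `e` carries `C (x ∘ (e × e))`
  have hcopy : ∀ (x : Fin m × Fin m → Bool) (e : ↥Γ),
      GateDAG.wire x (D.val x) (cw e oc.out) = C.eval (x ∘ dg e) := by
    intro x e
    rw [← GateDAG.evalOut_ofCircuit C (x ∘ dg e)]
    show GateDAG.wire x (D.val x) (cw e oc.out) =
      GateDAG.wire (x ∘ dg e) (oc.val (x ∘ dg e)) oc.out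
    cases oc.out with
    | inl q => rfl
    | inr k => exact hval x e k
  have hand : ∀ (k : ℕ) (v : Fin k → Bool), (GateFn.and k).2 v = true ↔ ∀ i, v i = true :=
    fun k v => by simp only [GateFn.and, decide_eq_true_eq]
  -- the compiled program
  refine ⟨D.compile, ?_, ?_, ?_, ?_⟩
  · -- size
    show D.compile.gates.length = N * C.gates.length + 1
    rw [D.compile_gates_length, Fintype.card_option, Fintype.card_prod, Fintype.card_fin]
  · -- basis
    intro B hB
    refine D.compile_isOver fun l => ?_
    cases l with
    | none => exact Set.mem_insert _ _
    | some p => exact Set.mem_insert_of_mem _ ((GateDAG.isOver_iff_ofCircuit C B).1 hB p.2)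
  · -- symmetry: `ρ' ∈ Γ` acts on the copies by left multiplication
    rw [GateDAG.isSymmetricUnder_compile_iff]
    rintro π ⟨ρ, hρ, rfl⟩
    let g : ↥Γ := ⟨ρ, hρ⟩
    let τ : ↥Γ ≃ ↥Γ :=
      ⟨fun e => g * e, fun e => g⁻¹ * e, fun e => inv_mul_cancel_left g e,
        fun e => mul_inv_cancel_left g e⟩
    let θ : Option (↥Γ × Fin C.gates.length) ≃ Option (↥Γ × Fin C.gates.length) :=
      Equiv.optionCongr (Equiv.prodCongr τ (Equiv.refl _))
    have hθ : ∀ (e : ↥Γ) (w : (Fin m × Fin m) ⊕ Fin C.gates.length),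
        Sum.map (fun q : Fin m × Fin m => (ρ q.1, ρ q.2)) θ (cw e w) = cw (g * e) w := by
      intro e w
      cases w with
      | inl q => rfl
      | inr k => rfl
    refine ⟨θ, rfl, ?_, ?_⟩
    · rintro (_ | ⟨e, k⟩) <;> rfl
    · rintro (_ | ⟨e, k⟩)
      · -- the `∧` gate: its argument list (the copies' outputs) is permuted
        show (List.ofFn fun a : Fin N => cw (enum.symm a) oc.out).Perm
          ((List.ofFn fun a : Fin N => cw (enum.symm a) oc.out).map
            (Sum.map (fun q : Fin m × Fin m => (ρ q.1, ρ q.2)) θ))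
        rw [List.map_ofFn]
        let σ : Equiv.Perm (Fin N) := enum.symm.trans (τ.trans enum)
        refine (Equiv.Perm.ofFn_comp_perm σ fun a : Fin N => cw (enum.symm a) oc.out).symm.trans
          (List.Perm.of_eq ?_)
        congr 1
        funext a
        show cw (enum.symm (enum (g * enum.symm a))) oc.out =
          Sum.map (fun q : Fin m × Fin m => (ρ q.1, ρ q.2)) θ (cw (enum.symm a) oc.out)
        rw [Equiv.symm_apply_apply, hθ]
      · -- a copy gate: its argument list is carried literally to that of its image
        show (List.ofFn fun a => cw (g * e) (oc.args k a)).Perm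
          ((List.ofFn fun a => cw e (oc.args k a)).map
            (Sum.map (fun q : Fin m × Fin m => (ρ q.1, ρ q.2)) θ))
        rw [List.map_ofFn]
        refine List.Perm.of_eq ?_
        congr 1
        funext a
        exact (hθ e _).symm
  · -- semantics: the `∧` of the copies
    intro x
    rw [D.compile_eval]
    show D.val x none = _
    rw [D.val_eq x none]
    change (GateFn.and N).2
      (fun a : Fin N => GateDAG.wire x (D.val x) (cw (enum.symm a) oc.out)) = _
    rw [Bool.eq_iff_iff, hand, decide_eq_true_iff]
    constructor
    · intro h ρ
      have h1 := h (enum ρ)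
      rw [Equiv.symm_apply_apply, hcopy] at h1
      exact h1
    · intro h a
      rw [hcopy]
      exact h _

/-- **The `g!`-symmetrisation sandwich over the budget** (the content of item `Symmetrise`, in
the named vocabulary of `SymmetricCircuit.lean`): with `c = 12`, for all `m g`, every
`Bud(m,g)`-invariant `f` and every `B₂`-circuit `C` computing `f`, some `Bud(m,g)`-symmetric
`tcBasis`-circuit of size `≤ 12 · (g! · (|C| + 1))` computes `f` (`B₂ → {∧₂,∨₂,¬}` costs
`≤ 12|C| + 3` gates, Jukna 2012 §1.2; then `|Bud(m,g)| ≤ g!` relabelled copies and one `∧`).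
[folklore] -/
theorem symmetrise_hasSymCircuit : ∃ c : ℕ, ∀ (m g : ℕ) (f : (Fin m × Fin m → Bool) → Bool),
    (∀ ρ ∈ pointStabiliserBudget m g, ∀ x : Fin m × Fin m → Bool,
        f (fun q : Fin m × Fin m => x (ρ q.1, ρ q.2)) = f x) →
      ∀ C : Circuit (Fin m × Fin m), C.IsOver B2 → C.Computes f →
        HasSymCircuit tcBasis (pointStabiliserBudget m g)
          (c * (Nat.factorial g * (C.size + 1))) f := by
  classical
  refine ⟨12, ?_⟩
  intro m g f hf C hB hC
  have hpos : 0 < 12 * (Nat.factorial g * (C.size + 1)) := by positivity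
  rcases Nat.eq_zero_or_pos m with rfl | hm
  · -- `m = 0`: `f` is constant; one `∧₀` (true) or `∨₀` (false) gate
    let x₀ : Fin 0 × Fin 0 → Bool := fun q => q.1.elim0
    have hx : ∀ x : Fin 0 × Fin 0 → Bool, x = x₀ := fun x => funext fun q => q.1.elim0
    have e : Fin 0 ≃ Fin 0 × Fin 0 := Equiv.equivOfIsEmpty _ _
    cases hb : f x₀
    · have h1 := hasSymCircuit_single (B := tcBasis) (f := GateFn.or 0)
        (acBasis_subset_tcBasis (Or.inr (Set.mem_iUnion.2 ⟨0, Or.inr rfl⟩))) e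
        (pointStabiliserBudget 0 g)
      have hfe : (fun x : Fin 0 × Fin 0 → Bool => (GateFn.or 0).2 fun a => x (e a)) = f := by
        funext x
        rw [hx x, hb]
        simp [GateFn.or]
      subst hfe
      exact h1.mono hpos
    · have h1 := hasSymCircuit_single (B := tcBasis) (f := GateFn.and 0)
        (acBasis_subset_tcBasis (Or.inr (Set.mem_iUnion.2 ⟨0, Or.inl rfl⟩))) e
        (pointStabiliserBudget 0 g)
      have hfe : (fun x : Fin 0 × Fin 0 → Bool => (GateFn.and 0).2 fun a => x (e a)) = f := by
        funext x
        rw [hx x, hb]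
        simp [GateFn.and]
      subst hfe
      exact h1.mono hpos
  · -- `m ≥ 1`: De Morgan rewriting, then symmetrisation over `Bud(m,g)`
    have i₀ : Fin m × Fin m := (⟨0, hm⟩, ⟨0, hm⟩)
    obtain ⟨C', hB', hC', hs'⟩ := C.exists_deMorgan_of_B2 hB i₀ hC
    obtain ⟨S, hsize, hover, hsymm, heval⟩ :=
      symmetrise_exists_symmetrisation (budgetSubgroup m g) C'
    refine ⟨S, ?_, ?_, hsymm, ?_⟩
    · refine (hover tcBasis (hB'.mono HamCompiles.Negative.deMorganBasis_subset_tcBasis)).mono ?_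
      exact Set.insert_subset
        (acBasis_subset_tcBasis (Or.inr (Set.mem_iUnion.2 ⟨_, Or.inl rfl⟩))) subset_rfl
    · rw [hsize]
      have h1 := symmetrise_card_budgetSubgroup_le m g
      have h2 : Fintype.card ↥(budgetSubgroup m g) * C'.size ≤
          g.factorial * (12 * C.size + 3) := Nat.mul_le_mul h1 hs'
      have h3 := Nat.factorial_pos g
      nlinarith [h2, h3]
    · intro x
      rw [heval]
      have key : ∀ ρ : ↥(budgetSubgroup m g),
          C'.eval (fun q : Fin m × Fin m =>
            x ((ρ : Equiv.Perm (Fin m)) q.1, (ρ : Equiv.Perm (Fin m)) q.2)) = f x :=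
        fun ρ => (hC' _).trans (hf ρ (Subgroup.mem_carrier.2 ρ.2) x)
      rw [Bool.eq_iff_iff, decide_eq_true_iff]
      constructor
      · intro h
        rw [← key 1]
        exact h 1
      · intro h ρ
        rw [key]
        exact h

/-- **Item `Symmetrise` (stmt-PneNP-2146) of route PneNP/SymmetryBudget, as stated**: there is a
constant `c` such that for all `m g`, every `Bud(m,g)`-invariant `f : (Fin m × Fin m → Bool) →
Bool` and every `B₂`-circuit `C` computing `f`, some `Bud(m,g)`-symmetric `tcBasis`-circuit of
size `≤ c · (g! · (|C| + 1))` computes `f`. The route's inline `let Sym/HasSym/Bud` unfold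
definitionally to `Circuit.IsSymmetricUnder`, `HasSymCircuit tcBasis`, `pointStabiliserBudget`,
so this is `symmetrise_hasSymCircuit` verbatim. [folklore] -/
theorem symmetrise_proof : Summit.PneNP.PneNP.Theses.SymmetryBudget.Symmetrise := by
  unfold Summit.PneNP.PneNP.Theses.SymmetryBudget.Symmetrise
  exact symmetrise_hasSymCircuit

end Summit.PneNP.PneNP.Theorems
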